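import Summits.ValiantsHypothesis.ValiantsHypothesis.Theorems.EquivariantDialNotchTransfer
import HarnessLib

/-!
# Equivariant dial — the INDEX LEMMA: induction of exactly equivariant layered programs

Support file for cell A (`EqHardBiPerm`, item `stmt-ValiantsHypothesis-23702` of the route
`DefinabilityGap/SymmetryDial`).  HONEST BOUNDARY (ENGINE): 0 S-currency; closes NO item; this file only
constructs the induced program `(1/r) · ⊕ᵢ P(aᵢ · x)` and its block-permutation lifts (Frobenius induction
of exactly equivariant layered programs, width cost = index) and proves nothing about `per_m`: P-ROW
(`𝔖_m × 1`) stays OPEN · IDEA-NEEDED and VP ≠ VNP is untouched.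
ENGINE (any field `k`; the construction itself over any commutative ring): let `Γ' ≤ Γ ≤ Stab(f)` in
`GL(σ)` have finite index `r = [Γ : Γ']` invertible in `k`, `f ≠ 0`, and let `P` be an exactly
`Γ'`-equivariant homogeneous layered program for `f` (`HasLayeredWidthLE Γ' f L w`).  For a left transversal `a₁ … a_r` of
`Γ / Γ'` the INDUCED PROGRAM `(1/r) · ⊕ᵢ P(aᵢ · x)` (`LayeredABP.induce`: block-diagonal transition
matrices `⊕ᵢ T_t(aᵢ · x)`, source weights `u / r`, sink weights `v` in every block) has length `L`,
width `w · r`, computes `(1/r) Σᵢ f(aᵢ · x) = f` (`LayeredABP.eval_induce`) and is exactly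
`Γ`-equivariant (`HasLayeredWidthLE.induce`, `HasLayeredWidthLE.of_relIndex`): writing
`γ aᵢ = a_{π i} hᵢ` (`hᵢ ∈ Γ'`, `exists_transversal_perm`) and taking exact lifts `Λᵢ` of `hᵢ` with
source/sink eigenvalues `1`, the block-permutation units `(⊕ᵢ R^{Λᵢ}_t) · (1 × π)` (`indGL`,
`LayeredABP.Lift.induce`, `blockDiagonal_perm`) lift `γ` exactly.  The normalisation rests on the
CHARACTER LEMMA `LayeredABP.Lift.linSubst_eval`: an exact lift of `γ` forces
`P.eval(γ · x) = (a/b) · P.eval(x)`, so on the stabiliser of `P.eval ≠ 0` every lift has `a = b`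
(`LayeredABP.Lift.a_eq_b`) and is rescaled to `a = b = 1` (`LayeredABP.Lift.scale`).  Consequences on
the dial are drawn in `EquivariantDialPolyIndex`.  Sources: exact lifts `A(γ·x) = g A(x) h⁻¹` as in
[LandsbergRessayre2017, §1–§2]; Frobenius induction for transfer matrices is [folklore].
-/

set_option linter.dupNamespace false

noncomputable section
namespace Summit.ValiantsHypothesis.ValiantsHypothesis.Theorems.EquivariantDialLayers

open MvPolynomial Matrix Literature.Computability.AlgebraicComplexity

section BlockAux
variable {α : Type*} [CommRing α] {m o : Type*}

/-- Block relabellings `1 × π` compose. [folklore] -/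
theorem prodCongr_refl_mul (π₁ π₂ : Equiv.Perm o) :
    (Equiv.prodCongr (Equiv.refl m) π₁ : Equiv.Perm (m × o)) * Equiv.prodCongr (Equiv.refl m) π₂ =
      Equiv.prodCongr (Equiv.refl m) (π₁ * π₂) :=
  Equiv.ext fun ⟨_, _⟩ => rfl

/-- The trivial block relabelling. [folklore] -/
theorem prodCongr_refl_one :
    (Equiv.prodCongr (Equiv.refl m) (1 : Equiv.Perm o) : Equiv.Perm (m × o)) = 1 :=
  Equiv.ext fun ⟨_, _⟩ => rfl

/-- The block-diagonal matrix with identity blocks (lambda form of `blockDiagonal_one`). [folklore] -/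
theorem blockDiagonal_one' [DecidableEq m] [DecidableEq o] :
    blockDiagonal (fun _ : o => (1 : Matrix m m α)) = 1 :=
  blockDiagonal_one

/-- A row vector repeated along the blocks times a block-diagonal matrix, blockwise. [folklore] -/
theorem vecMul_blockDiagonal_fst [Fintype m] [Fintype o] [DecidableEq o] (x : m → α)
    (B : o → Matrix m m α) :
    (x ∘ Prod.fst) ᵥ* blockDiagonal B = fun q : m × o => (x ᵥ* B q.2) q.1 := by
  funext q
  simp only [vecMul, dotProduct, Function.comp_apply, blockDiagonal_apply, Fintype.sum_prod_type, mul_ite,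
    mul_zero, Finset.sum_ite_eq', Finset.mem_univ, if_true]

/-- A block-diagonal matrix times a column vector repeated along the blocks, blockwise. [folklore] -/
theorem blockDiagonal_mulVec_fst [Fintype m] [Fintype o] [DecidableEq o] (B : o → Matrix m m α)
    (x : m → α) :
    blockDiagonal B *ᵥ (x ∘ Prod.fst) = fun q : m × o => (B q.2 *ᵥ x) q.1 := by
  funext q
  simp only [mulVec, dotProduct, Function.comp_apply, blockDiagonal_apply, Fintype.sum_prod_type, ite_mul,
    zero_mul, Finset.sum_ite_eq, Finset.mem_univ, if_true]
end BlockAux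

section BlockAlgebra
variable {α : Type*} [CommRing α] {m o : Type*} [Fintype m] [DecidableEq m] [Fintype o] [DecidableEq o]

/-- Conjugating a block-diagonal matrix by the block relabelling `1 × π` relabels the blocks:
`(1 × π) · (⊕ᵢ Mᵢ) · (1 × π)⁻¹ = ⊕ᵢ M_{π i}`. [folklore] -/
theorem blockDiagonal_perm (M : o → Matrix m m α) (π : Equiv.Perm o) :
    Equiv.Perm.permMatrix α (Equiv.prodCongr (Equiv.refl m) π) * blockDiagonal M *
        Equiv.Perm.permMatrix α (Equiv.prodCongr (Equiv.refl m) π⁻¹) =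
      blockDiagonal fun i => M (π i) := by
  rw [PEquiv.toMatrix_toPEquiv_mul, PEquiv.mul_toMatrix_toPEquiv, submatrix_submatrix]
  ext ⟨p, i⟩ ⟨q, j⟩
  simp [blockDiagonal_apply, Equiv.Perm.inv_def]
end BlockAlgebra

section InducedUnit
variable {k : Type*} [CommRing k] {w r : ℕ}

/-- The block-permutation unit `(⊕ᵢ Dᵢ) · (1 × π) ∈ GL_{w·r}(k)` (blocks indexed by `Fin r`, the
product index flattened by `finProdFinEquiv`). [folklore] -/
def indGL (D : Fin r → GL (Fin w) k) (π : Equiv.Perm (Fin r)) : GL (Fin (w * r)) k :=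
  ⟨(blockDiagonal (fun i => (D i : Matrix (Fin w) (Fin w) k)) *
        Equiv.Perm.permMatrix k (Equiv.prodCongr (Equiv.refl (Fin w)) π)).submatrix
      finProdFinEquiv.symm finProdFinEquiv.symm,
    (Equiv.Perm.permMatrix k (Equiv.prodCongr (Equiv.refl (Fin w)) π⁻¹) *
        blockDiagonal (fun i => ((D i)⁻¹ : GL (Fin w) k))).submatrix
      finProdFinEquiv.symm finProdFinEquiv.symm,
    by
      rw [submatrix_mul_equiv, Matrix.mul_assoc, ← Matrix.mul_assoc (Equiv.Perm.permMatrix k _),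
        ← Matrix.permMatrix_mul, prodCongr_refl_mul, inv_mul_cancel, prodCongr_refl_one,
        Matrix.permMatrix_one, Matrix.one_mul, ← blockDiagonal_mul]
      simp only [Units.mul_inv, blockDiagonal_one', submatrix_one_equiv],
    by
      rw [submatrix_mul_equiv, Matrix.mul_assoc, ← Matrix.mul_assoc (blockDiagonal _),
        ← blockDiagonal_mul]
      simp only [Units.inv_mul, blockDiagonal_one', Matrix.one_mul]
      rw [← Matrix.permMatrix_mul, prodCongr_refl_mul, mul_inv_cancel, prodCongr_refl_one,
        Matrix.permMatrix_one, submatrix_one_equiv]⟩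

/-- The matrix of `indGL`. [folklore] -/
theorem coe_indGL (D : Fin r → GL (Fin w) k) (π : Equiv.Perm (Fin r)) :
    (indGL D π : Matrix (Fin (w * r)) (Fin (w * r)) k) =
      (blockDiagonal (fun i => (D i : Matrix (Fin w) (Fin w) k)) *
        Equiv.Perm.permMatrix k (Equiv.prodCongr (Equiv.refl (Fin w)) π)).submatrix
          finProdFinEquiv.symm finProdFinEquiv.symm := rfl

/-- The matrix of the inverse of `indGL`. [folklore] -/
theorem coe_indGL_inv (D : Fin r → GL (Fin w) k) (π : Equiv.Perm (Fin r)) :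
    (((indGL D π)⁻¹ : GL (Fin (w * r)) k) : Matrix (Fin (w * r)) (Fin (w * r)) k) =
      (Equiv.Perm.permMatrix k (Equiv.prodCongr (Equiv.refl (Fin w)) π⁻¹) *
        blockDiagonal (fun i => ((D i)⁻¹ : GL (Fin w) k))).submatrix
          finProdFinEquiv.symm finProdFinEquiv.symm := rfl

end InducedUnit

namespace LayeredABP
variable {σ : Type*} {k : Type*} [CommRing k] [Fintype σ] [DecidableEq σ] {L w r : ℕ}

/-- Substitution of variables in an identity matrix. [folklore] -/
theorem linSubstEntries_one_right {ι : Type*} [DecidableEq ι] (γ : GL σ k) :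
    Matrix.linSubstEntries γ (1 : Matrix ι ι (MvPolynomial σ k)) = 1 :=
  Matrix.map_one (linSubst σ k (γ : Matrix σ σ k)) (map_zero _) (map_one _)

/-- Substitution of variables commutes with re-indexing. [folklore] -/
theorem linSubstEntries_submatrix {ι ι' : Type*} (γ : GL σ k) (A : Matrix ι ι (MvPolynomial σ k))
    (e₁ e₂ : ι' → ι) :
    Matrix.linSubstEntries γ (A.submatrix e₁ e₂) = (Matrix.linSubstEntries γ A).submatrix e₁ e₂ :=
  rfl

/-- Substitution of variables in a block-diagonal matrix, block by block. [folklore] -/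
theorem linSubstEntries_blockDiagonal {ι o : Type*} [DecidableEq o] (γ : GL σ k)
    (M : o → Matrix ι ι (MvPolynomial σ k)) :
    Matrix.linSubstEntries γ (blockDiagonal M) = blockDiagonal fun i => Matrix.linSubstEntries γ (M i) :=
  blockDiagonal_map M (linSubst σ k (γ : Matrix σ σ k)) (map_zero _)

/-- The INDUCED PROGRAM `c · ⊕ᵢ P(aᵢ · x)`: in every edge layer the block-diagonal matrix of the
substituted transition matrices `T_t(aᵢ · x)`, source weights `c · u` and sink weights `v` repeated in
every block (Frobenius induction for transfer matrices). [folklore] -/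
def induce (P : LayeredABP σ k L w) (a : Fin r → GL σ k) (c : k) : LayeredABP σ k L (w * r) where
  T t := (blockDiagonal fun i => Matrix.linSubstEntries (a i) (P.T t)).submatrix
    finProdFinEquiv.symm finProdFinEquiv.symm
  u p := c * P.u (finProdFinEquiv.symm p).1
  v p := P.v (finProdFinEquiv.symm p).1
  linear t p q := by
    simp only [submatrix_apply, blockDiagonal_apply, Matrix.linSubstEntries_apply]
    split_ifs
    · exact linSubst_isHomogeneous _ (P.linear t _ _)
    · exact isHomogeneous_zero σ k 1

/-- Products of block-diagonal substituted matrices, block by block. [folklore] -/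
theorem prod_ofFn_blockSubst {d : ℕ} (a : Fin r → GL σ k)
    (g : Fin d → Matrix (Fin w) (Fin w) (MvPolynomial σ k)) :
    (List.ofFn fun t => (blockDiagonal fun i => Matrix.linSubstEntries (a i) (g t)).submatrix
        finProdFinEquiv.symm finProdFinEquiv.symm).prod =
      (blockDiagonal fun i => Matrix.linSubstEntries (a i) (List.ofFn g).prod).submatrix
        (finProdFinEquiv.symm : Fin (w * r) → Fin w × Fin r) finProdFinEquiv.symm := by
  induction d with
  | zero =>
    simp only [List.ofFn_zero, List.prod_nil, linSubstEntries_one_right, blockDiagonal_one',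
      submatrix_one_equiv]
  | succ d ih =>
    rw [List.ofFn_succ, List.prod_cons, List.ofFn_succ, List.prod_cons, ih (fun t => g t.succ),
      submatrix_mul_equiv, ← blockDiagonal_mul]
    simp only [Matrix.linSubstEntries_mul]

/-- The total transfer matrix of the induced program is the block-diagonal matrix of the
substituted total transfer matrices. [folklore] -/
theorem prodT_induce (P : LayeredABP σ k L w) (a : Fin r → GL σ k) (c : k) :
    (P.induce a c).prodT = (blockDiagonal fun i => Matrix.linSubstEntries (a i) P.prodT).submatrix
      finProdFinEquiv.symm finProdFinEquiv.symm := by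
  simp only [prodT]; exact prod_ofFn_blockSubst a P.T

/-- Substituting the variables in the computed polynomial = substituting them in the total transfer
matrix (the weights are constants). [folklore] -/
theorem linSubst_eval_eq (P : LayeredABP σ k L w) (γ : GL σ k) :
    linSubst σ k (γ : Matrix σ σ k) P.eval =
      (fun i => C (P.u i)) ⬝ᵥ (Matrix.linSubstEntries γ P.prodT *ᵥ fun j => C (P.v j)) := by
  simp only [eval, dotProduct, mulVec, map_sum, map_mul, linSubst_C, Matrix.linSubstEntries_apply]

/-- The induced program computes `c · Σᵢ P.eval(aᵢ · x)`. [folklore] -/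
theorem eval_induce (P : LayeredABP σ k L w) (a : Fin r → GL σ k) (c : k) :
    (P.induce a c).eval = C c * ∑ i, linSubst σ k (a i : Matrix σ σ k) P.eval := by
  have hu : (fun p : Fin (w * r) => (C ((P.induce a c).u p) : MvPolynomial σ k)) =
      ((fun q : Fin w × Fin r => (C c * C (P.u q.1) : MvPolynomial σ k)) ∘
        ⇑(finProdFinEquiv.symm : Fin (w * r) ≃ _)) := by
    funext p; simp only [LayeredABP.induce, Function.comp_apply, map_mul]
  have hv : ((fun p : Fin (w * r) => (C ((P.induce a c).v p) : MvPolynomial σ k)) ∘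
        ⇑(finProdFinEquiv.symm.symm : Fin w × Fin r ≃ Fin (w * r))) =
      ((fun j : Fin w => (C (P.v j) : MvPolynomial σ k)) ∘ Prod.fst) := by
    funext q; simp only [LayeredABP.induce, Function.comp_apply, Equiv.symm_symm, Equiv.symm_apply_apply]
  rw [LayeredABP.eval, prodT_induce, submatrix_mulVec_equiv, hv, hu, comp_equiv_dotProduct_comp_equiv,
    blockDiagonal_mulVec_fst, Finset.mul_sum]
  simp only [dotProduct, Fintype.sum_prod_type, linSubst_eval_eq, Finset.mul_sum, mul_assoc]
  exact Finset.sum_comm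

/-- Rescaling an exact lift by a constant unit `s`: `R t ↦ s · R t`, `a ↦ s a`, `b ↦ s b`. [folklore] -/
def Lift.scale {P : LayeredABP σ k L w} {γ : GL σ k} (Λ : P.Lift γ) (s : kˣ) : P.Lift γ where
  R t := scalarGL w s * Λ.R t
  a := s * Λ.a
  b := s * Λ.b
  layer t := by
    rw [Λ.layer t, Units.val_mul, coe_scalarGL, _root_.mul_inv_rev, Units.val_mul, coe_scalarGL_inv,
      Matrix.map_mul, Matrix.map_mul, diagonal_map (map_zero C), diagonal_map (map_zero C),
      ← smul_eq_diagonal_mul, ← smul_eq_mul_diagonal, Matrix.smul_mul, Matrix.smul_mul,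
      Matrix.mul_smul, smul_smul, ← map_mul, Units.mul_inv, C_1, one_smul]
  src := by
    rw [Units.val_mul, coe_scalarGL, ← smul_eq_diagonal_mul, vecMul_smul, Λ.src, smul_smul,
      Units.val_mul]
  snk := by
    rw [Units.val_mul, coe_scalarGL, ← smul_eq_diagonal_mul, smul_mulVec, Λ.snk, smul_smul,
      Units.val_mul]

/-- Telescoping the layer equations of an exact lift:
`(T 0 ⋯ T (L-1))(γ · x) = R 0 · (T 0 ⋯ T (L-1)) · (R L)⁻¹`. [folklore] -/
theorem Lift.prodT_map {P : LayeredABP σ k L w} {γ : GL σ k} (Λ : P.Lift γ) :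
    Matrix.linSubstEntries γ P.prodT =
      ((Λ.R 0 : GL (Fin w) k) : Matrix (Fin w) (Fin w) k).map C * P.prodT *
        (((Λ.R (Fin.last L))⁻¹ : GL (Fin w) k) : Matrix (Fin w) (Fin w) k).map C := by
  have h1 : Matrix.linSubstEntries γ P.prodT =
      (List.ofFn fun t => Matrix.linSubstEntries γ (P.T t)).prod := by
    rw [Matrix.linSubstEntries, prodT, ← AlgHom.mapMatrix_apply, map_list_prod, List.map_ofFn]
    rfl
  have h2 := prod_ofFn_telescope P.T (fun t => Matrix.linSubstEntries γ (P.T t))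
    (fun t => glC (σ := σ) w (Λ.R t)) fun t => by
      rw [coe_glC, coe_glC_inv]; exact Λ.layer t
  rw [coe_glC, coe_glC_inv] at h2
  rw [h1, prodT]
  exact h2

/-- ★ CHARACTER LEMMA.  An exact layerwise lift `Λ` of `γ` forces `P.eval(γ · x) = (a/b) · P.eval(x)`:
the program's polynomial is a relative invariant of every exactly lifted substitution, with character
`a b⁻¹` read off the source and sink eigenvalues. [folklore] -/
theorem Lift.linSubst_eval {P : LayeredABP σ k L w} {γ : GL σ k} (Λ : P.Lift γ) :
    linSubst σ k (γ : Matrix σ σ k) P.eval = ((Λ.a * Λ.b⁻¹ : kˣ) : k) • P.eval := by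
  have hu : (fun l => (C (P.u l) : MvPolynomial σ k)) ᵥ*
        ((Λ.R 0 : GL (Fin w) k) : Matrix (Fin w) (Fin w) k).map C =
      (C (Λ.a : k) : MvPolynomial σ k) • fun l => (C (P.u l) : MvPolynomial σ k) := by
    have hC : (fun l => C (P.u l)) = (C : k → MvPolynomial σ k) ∘ P.u := rfl
    funext l
    rw [hC, ← RingHom.map_vecMul, Λ.src, Pi.smul_apply, Pi.smul_apply, Function.comp_apply,
      smul_eq_mul, smul_eq_mul, map_mul]
  have hv0 : (((Λ.R (Fin.last L))⁻¹ : GL (Fin w) k) : Matrix (Fin w) (Fin w) k) *ᵥ P.v =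
      ((Λ.b⁻¹ : kˣ) : k) • P.v := by
    have h := congrArg (fun x => (((Λ.R (Fin.last L))⁻¹ : GL (Fin w) k) : Matrix (Fin w) (Fin w) k) *ᵥ x)
      Λ.snk
    simp only [mulVec_mulVec, Units.inv_mul, one_mulVec, mulVec_smul] at h
    conv_rhs => rw [h]
    rw [smul_smul, Units.inv_mul, one_smul]
  have hv : (((Λ.R (Fin.last L))⁻¹ : GL (Fin w) k) : Matrix (Fin w) (Fin w) k).map C *ᵥ
        (fun j => (C (P.v j) : MvPolynomial σ k)) =
      (C ((Λ.b⁻¹ : kˣ) : k) : MvPolynomial σ k) • fun j => (C (P.v j) : MvPolynomial σ k) := by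
    have hC : (fun j => C (P.v j)) = (C : k → MvPolynomial σ k) ∘ P.v := rfl
    funext j
    rw [hC, ← RingHom.map_mulVec, hv0, Pi.smul_apply, Pi.smul_apply, Function.comp_apply,
      smul_eq_mul, smul_eq_mul, map_mul]
  rw [linSubst_eval_eq, Λ.prodT_map, ← mulVec_mulVec, ← mulVec_mulVec, hv, mulVec_smul, mulVec_smul,
    dotProduct_smul, dotProduct_mulVec, hu, smul_dotProduct, smul_smul, ← LayeredABP.eval, smul_eq_mul,
    smul_eq_C_mul, ← map_mul, Units.val_mul, mul_comm ((Λ.b⁻¹ : kˣ) : k)]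

/-- The BLOCK-PERMUTATION LIFT of `γ` to the induced program: if `γ aᵢ = a_{π i} hᵢ` and `Λᵢ` is an
exact lift of `hᵢ` to `P` with source and sink eigenvalues `1`, then `R t := (⊕ᵢ R^{Λᵢ}_t) · (1 × π)`
is an exact layerwise lift of `γ` to `P.induce a c`, with eigenvalues `1`. [folklore] -/
def Lift.induce (P : LayeredABP σ k L w) (a : Fin r → GL σ k) (c : k) {γ : GL σ k}
    (π : Equiv.Perm (Fin r)) (h : Fin r → GL σ k) (hγ : ∀ i, γ * a i = a (π i) * h i)
    (Λ : ∀ i, P.Lift (h i)) (ha : ∀ i, (Λ i).a = 1) (hb : ∀ i, (Λ i).b = 1) :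
    (P.induce a c).Lift γ where
  R t := indGL (fun i => (Λ i).R t) π
  a := 1
  b := 1
  layer t := by
    have hlayer : ∀ i, Matrix.linSubstEntries (h i) (P.T t) =
        (((Λ i).R t.castSucc : GL (Fin w) k) : Matrix (Fin w) (Fin w) k).map C * P.T t *
          ((((Λ i).R t.succ)⁻¹ : GL (Fin w) k) : Matrix (Fin w) (Fin w) k).map C :=
      fun i => (Λ i).layer t
    dsimp only [LayeredABP.induce]
    rw [linSubstEntries_submatrix, linSubstEntries_blockDiagonal]
    simp_rw [Matrix.linSubstEntries_linSubstEntries, hγ, ← Matrix.linSubstEntries_linSubstEntries,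
      hlayer, Matrix.linSubstEntries_mul, Matrix.linSubstEntries_map_C]
    rw [coe_indGL, coe_indGL_inv, ← submatrix_map, ← submatrix_map, submatrix_mul_equiv,
      submatrix_mul_equiv]
    congr 1
    rw [Matrix.map_mul, Matrix.map_mul, permMatrix_map, permMatrix_map,
      blockDiagonal_map _ _ (map_zero C), blockDiagonal_map _ _ (map_zero C),
      Matrix.mul_assoc (blockDiagonal _), Matrix.mul_assoc (blockDiagonal _),
      ← Matrix.mul_assoc _ (Equiv.Perm.permMatrix _ _) (blockDiagonal _), blockDiagonal_perm,
      ← blockDiagonal_mul, ← blockDiagonal_mul]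
    simp only [Matrix.mul_assoc]
  src := by
    have hD : ∀ i, P.u ᵥ* (((Λ i).R 0 : GL (Fin w) k) : Matrix (Fin w) (Fin w) k) = P.u :=
      fun i => by rw [(Λ i).src, ha i, Units.val_one, one_smul]
    have hcu : ((fun p : Fin (w * r) => c * P.u (finProdFinEquiv.symm p).1) ∘
        ⇑(finProdFinEquiv.symm.symm : Fin w × Fin r ≃ Fin (w * r))) = (c • P.u) ∘ Prod.fst := by
      funext q
      simp only [Function.comp_apply, Equiv.symm_symm, Equiv.symm_apply_apply, Pi.smul_apply, smul_eq_mul]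
    dsimp only [LayeredABP.induce]
    rw [coe_indGL, submatrix_vecMul_equiv, hcu, ← vecMul_vecMul, vecMul_blockDiagonal_fst,
      Units.val_one, one_smul]
    simp only [smul_vecMul, hD, vecMul_permMatrix]
    funext p; simp
  snk := by
    have hD : ∀ i, (((Λ i).R (Fin.last L) : GL (Fin w) k) : Matrix (Fin w) (Fin w) k) *ᵥ P.v = P.v :=
      fun i => by rw [(Λ i).snk, hb i, Units.val_one, one_smul]
    have hcv : ((fun p : Fin (w * r) => P.v (finProdFinEquiv.symm p).1) ∘
        ⇑(finProdFinEquiv.symm.symm : Fin w × Fin r ≃ Fin (w * r))) = P.v ∘ Prod.fst := by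
      funext q; simp only [Function.comp_apply, Equiv.symm_symm, Equiv.symm_apply_apply]
    have hρ : ((P.v ∘ Prod.fst) ∘ ⇑(Equiv.prodCongr (Equiv.refl (Fin w)) π)) = P.v ∘ Prod.fst := by
      funext q; simp
    dsimp only [LayeredABP.induce]
    rw [coe_indGL, submatrix_mulVec_equiv, hcv, ← mulVec_mulVec, permMatrix_mulVec, hρ,
      blockDiagonal_mulVec_fst, Units.val_one, one_smul]
    funext p; simp only [Function.comp_apply, hD]
end LayeredABP

section Induction
variable {σ : Type*} {k : Type*} [Field k] [Fintype σ] [DecidableEq σ]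

/-- On the stabiliser of a non-zero computed polynomial every exact lift has equal source and sink
eigenvalues (the character of the character lemma is `1`). [folklore] -/
theorem LayeredABP.Lift.a_eq_b {L w : ℕ} {P : LayeredABP σ k L w} {γ : GL σ k} (Λ : P.Lift γ)
    (hf : P.eval ≠ 0) (hγ : linSubst σ k (γ : Matrix σ σ k) P.eval = P.eval) : Λ.a = Λ.b := by
  have h1 := Λ.linSubst_eval
  rw [hγ, smul_eq_C_mul] at h1
  have h2 : (C (((Λ.a * Λ.b⁻¹ : kˣ)) : k) : MvPolynomial σ k) = C 1 :=
    mul_right_cancel₀ hf (by rw [C_1, one_mul]; exact h1.symm)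
  exact mul_inv_eq_one.mp (Units.val_eq_one.mp (C_injective σ k h2))

/-- ★ INDUCTION ALONG AN EXPLICIT TRANSVERSAL.  If `f ≠ 0` is computed by an exactly `Γ'`-equivariant
layered program of width `w`, `Γ ≥ Γ'` fixes `f`, `a : Fin r → Γ` is permuted by left multiplication
by `Γ` modulo `Γ'` (`γ aᵢ = a_{π i} hᵢ`, `hᵢ ∈ Γ'`) and `c · r = 1`, then `c · ⊕ᵢ P(aᵢ · x)` is an
exactly `Γ`-equivariant layered program of the same length and width `w · r` computing `f`.
[folklore] -/
theorem HasLayeredWidthLE.induce {Γ Γ' : Subgroup (GL σ k)} {f : MvPolynomial σ k} {L w r : ℕ}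
    (hP : HasLayeredWidthLE Γ' f L w) (hf : f ≠ 0)
    (hΓ : ∀ γ ∈ Γ, linSubst σ k (γ : Matrix σ σ k) f = f) (hle : Γ' ≤ Γ)
    (a : Fin r → GL σ k) (ha : ∀ i, a i ∈ Γ)
    (hcos : ∀ γ ∈ Γ, ∃ π : Equiv.Perm (Fin r), ∀ i, ∃ h ∈ Γ', γ * a i = a (π i) * h)
    (c : k) (hc : c * r = 1) : HasLayeredWidthLE Γ f L (w * r) := by
  classical
  obtain ⟨P, hPeq, hPev⟩ := hP
  subst hPev
  refine ⟨P.induce a c, fun γ hγ => ?_, ?_⟩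
  · obtain ⟨π, hπ⟩ := hcos γ hγ
    choose h hh hγa using hπ
    obtain ⟨Λ0⟩ : Nonempty (∀ i, P.Lift (h i)) := ⟨fun i => (hPeq (h i) (hh i)).some⟩
    have key : ∀ i, (Λ0 i).a = (Λ0 i).b := fun i => (Λ0 i).a_eq_b hf (hΓ _ (hle (hh i)))
    refine ⟨LayeredABP.Lift.induce P a c π h hγa (fun i => (Λ0 i).scale (Λ0 i).a⁻¹)
      (fun i => inv_mul_cancel (Λ0 i).a) fun i => ?_⟩
    show (Λ0 i).a⁻¹ * (Λ0 i).b = 1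
    rw [← key i, inv_mul_cancel]
  · rw [LayeredABP.eval_induce, Finset.sum_congr rfl fun i _ => hΓ _ (ha i), Finset.sum_const,
      Finset.card_univ, Fintype.card_fin, nsmul_eq_mul, ← mul_assoc, ← map_natCast C r, ← map_mul, hc,
      C_1, one_mul]

/-- A subgroup `Γ'` of finite index `r` in `Γ` has a left transversal `a : Fin r → Γ`, and left
multiplication by `γ ∈ Γ` permutes the cosets: `γ aᵢ = a_{π i} hᵢ` with `hᵢ ∈ Γ'`. [folklore] -/
theorem exists_transversal_perm {G : Type*} [Group G] {Γ Γ' : Subgroup G}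
    (hr : Γ'.relIndex Γ ≠ 0) :
    ∃ a : Fin (Γ'.relIndex Γ) → G, (∀ i, a i ∈ Γ) ∧
      ∀ γ ∈ Γ, ∃ π : Equiv.Perm (Fin (Γ'.relIndex Γ)), ∀ i, ∃ h ∈ Γ', γ * a i = a (π i) * h := by
  classical
  have e : (Γ ⧸ Γ'.subgroupOf Γ) ≃ Fin (Γ'.relIndex Γ) := Nat.equivFinOfCardPos hr
  refine ⟨fun i => (((e.symm i).out : Γ) : G), fun i => ((e.symm i).out).2, fun γ hγ => ?_⟩
  refine ⟨(e.symm.trans (MulAction.toPerm (⟨γ, hγ⟩ : Γ))).trans e, fun i => ?_⟩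
  have hπ : e.symm (((e.symm.trans (MulAction.toPerm (⟨γ, hγ⟩ : Γ))).trans e) i) =
      (⟨γ, hγ⟩ : Γ) • e.symm i := by
    simp only [Equiv.trans_apply, Equiv.symm_apply_apply, MulAction.toPerm_apply]
  obtain ⟨h₀, hh₀⟩ := QuotientGroup.mk_out_eq_mul (Γ'.subgroupOf Γ) ((⟨γ, hγ⟩ : Γ) * (e.symm i).out)
  have hh : (((⟨γ, hγ⟩ : Γ) • e.symm i).out : Γ) = (⟨γ, hγ⟩ : Γ) * (e.symm i).out * h₀ := by
    rw [← MulAction.Quotient.mk_smul_out, smul_eq_mul]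
    exact hh₀
  refine ⟨(((h₀ : Γ) : G))⁻¹, Γ'.inv_mem (Subgroup.mem_subgroupOf.mp h₀.2), ?_⟩
  simp only [hπ, hh, Subgroup.coe_mul, mul_inv_cancel_right]

/-- ★ THE INDEX LEMMA.  For `Γ' ≤ Γ ≤ Stab(f)` with `f ≠ 0` and `[Γ : Γ']` finite and invertible in
`k`, an exactly `Γ'`-equivariant homogeneous layered program for `f` of length `L` and width `w`
induces an exactly `Γ`-equivariant one of length `L` and width `w · [Γ : Γ']`. [folklore] -/
theorem HasLayeredWidthLE.of_relIndex {Γ Γ' : Subgroup (GL σ k)} {f : MvPolynomial σ k} {L w : ℕ}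
    (hP : HasLayeredWidthLE Γ' f L w) (hf : f ≠ 0) (hle : Γ' ≤ Γ) (hΓ : Γ ≤ linStabilizer f)
    (hr : ((Γ'.relIndex Γ : ℕ) : k) ≠ 0) : HasLayeredWidthLE Γ f L (w * Γ'.relIndex Γ) := by
  have hr0 : Γ'.relIndex Γ ≠ 0 := fun h => hr (by rw [h, Nat.cast_zero])
  obtain ⟨a, ha, hcos⟩ := exists_transversal_perm hr0
  exact hP.induce hf (fun γ hγ => by simpa only [mem_linStabilizer, linSubstRep_apply] using hΓ hγ)
    hle a ha hcos _ (inv_mul_cancel₀ hr)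
end Induction

end Summit.ValiantsHypothesis.ValiantsHypothesis.Theorems.EquivariantDialLayers
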